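import Literature.Analysis.FluidPDE.MixedNormSmooth
import Mathlib.MeasureTheory.Integral.MeanInequalities
import Mathlib.Analysis.SpecialFunctions.Pow.Deriv
import Mathlib.Analysis.Calculus.MeanValue
import Mathlib.MeasureTheory.Integral.IntervalIntegral.FundThmCalculus
import HarnessLib

/-!
# `L^r`-accretivity of the heat flow on the flat torus: the energy estimate for `∂ₜθ = κΔθ + g`

Analysis/FluidPDE support file (all results proved). For a classical solution `θ` of the forced
heat equation `∂ₜθ = κΔθ + g` on `[a, b] × 𝕋^d` (`κ ≥ 0`; `θ`, `g` jointly `C^∞` up to the time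
boundary, one-sided time derivatives, `θ(a) = 0`) and `1 < r < ∞`,

  `‖θ(t)‖_{L^r(𝕋^d)} ≤ ∫ₐᵗ ‖g(s)‖_{L^r(𝕋^d)} ds`   (`t ∈ [a, b]`)

(`Torus.eLpNorm_le_integral_of_heat`). This is the "standard energy method" step in the proof of
Cheskidov–Luo 2022, Prop. 3.2 (arXiv:2009.06596, p. 14: "`∂ₜz - Δz = F` … a standard energy method
yields `‖z(t)‖_{L^r(𝕋^d)} ≤ C_r ∫_{tᵢ}^t ‖F(s)‖_r ds`"), isolated for the discharge of the named fact
`Torus.CheskidovLuo2022AntidivergenceBound` (`NavierStokesConcentrationCorrectorFacts`), where it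
is applied componentwise to the heat-flow antidivergence. Proof: for `η > 0` the regularised
power `φ_η(y) = (y² + η²)^{r/2}` is smooth and convex, so `N(t) = ∫ φ_η(θ(t))` has
`N' = ∫ φ_η'(θ)(κΔθ + g) ≤ ∫ φ_η'(θ) g` (integration by parts: `∫ φ_η'(θ)Δθ = -∫ φ_η''(θ)|∇θ|² ≤ 0`)
`≤ ‖φ_η'(θ)‖_{r'} ‖g‖_r ≤ r N^{1/r'} ‖g‖_r` (Hölder and `|φ_η'| ≤ r φ_η^{1/r'}`), i.e.
`(N^{1/r})' ≤ ‖g‖_r`, whence `‖θ(t)‖_r ≤ N(t)^{1/r} ≤ η + ∫ₐᵗ ‖g‖_r`; let `η → 0`.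

The continuity in time of the slice norms `t ↦ ‖g(t)‖_{L^r}` (so that the time integral is
genuine) is the tree's `Torus.IsSmoothSpaceTimeOn.continuousOn_eLpNorm_toReal` (`MixedNormSmooth`).

## Mathlib / tree search

Mathlib: Hölder `integral_mul_le_Lp_mul_Lq_of_nonneg`, `MemLp.eLpNorm_eq_integral_rpow_norm`,
`HasDerivWithinAt.rpow_const`, the comparison principle `image_le_of_deriv_right_le_deriv_boundary`,
FTC `intervalIntegral.integral_hasDerivAt_right`; no heat equation on the torus. Tree:
`Torus.IsSmoothSpaceTimeOn.hasDerivWithinAt_integral` (differentiation under `∫`),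
`Torus.integral_mul_laplacian_eq_neg_sum` (Green), `Torus.hasDerivAt_comp_add_proj_smul` (chain
rule along coordinate lines), `Torus.IsSmoothSpaceTimeOn.continuousOn_eLpNorm_toReal`
(`MixedNormSmooth`, continuity of slice norms).

## References

* A. Cheskidov, X. Luo, *Sharp nonuniqueness for the Navier–Stokes equations*, Invent. Math. 229
  (2022) = arXiv:2009.06596, Prop. 3.2 (proof, "standard energy method"). [`CheskidovLuo2022`]
* L. C. Evans, *Partial Differential Equations*, 2nd ed. (2010), §7.1.2 (energy estimates for
  parabolic equations), App. C.2 Thm. 3 (Green's identities). [`Evans2010`]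
-/

open MeasureTheory Set Filter Topology
open scoped ENNReal NNReal ContDiff

noncomputable section

namespace Literature.Analysis.FluidPDE

namespace Torus

open Literature.Analysis.FunctionSpaces.Torus (proj IsSmoothSpaceTimeOn IsSmooth IsContDiff
  hasDerivAt_comp_add_proj_smul integral_mul_laplacian_eq_neg_sum proj_zero)

variable {d : Type*} [Fintype d]

/-! ## The regularised power `φ_η(y) = (y² + η²)^{r/2}` -/

section RegPow

variable {r η : ℝ}

/-- The regularised `r`-th power `φ(y) = (y² + η²)^{r/2}` (`η > 0`), a smooth convex substitute
for `|y|^r`. [folklore] -/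
def regPow (r η : ℝ) (y : ℝ) : ℝ := (y ^ 2 + η ^ 2) ^ (r / 2)

/-- Its derivative `φ'(y) = r y (y² + η²)^{r/2 - 1}`. [folklore] -/
def regPowDeriv (r η : ℝ) (y : ℝ) : ℝ := r * y * (y ^ 2 + η ^ 2) ^ (r / 2 - 1)

/-- Its second derivative `φ''(y) = r (y² + η²)^{r/2 - 2} ((r - 1) y² + η²)`. [folklore] -/
def regPowDeriv₂ (r η : ℝ) (y : ℝ) : ℝ :=
  r * (y ^ 2 + η ^ 2) ^ (r / 2 - 2) * ((r - 1) * y ^ 2 + η ^ 2)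

/-- The base `y² + η²` is positive for `η > 0`. [folklore] -/
theorem regPow_base_pos (hη : 0 < η) (y : ℝ) : 0 < y ^ 2 + η ^ 2 := by positivity

/-- `φ` is smooth (`η > 0`). [folklore] -/
theorem contDiff_regPow (hη : 0 < η) : ContDiff ℝ ∞ (regPow r η) := by
  unfold regPow
  exact (contDiff_id.pow 2 |>.add contDiff_const).rpow_const_of_ne fun y => (regPow_base_pos hη y).ne'

/-- `φ'` is smooth (`η > 0`). [folklore] -/
theorem contDiff_regPowDeriv (hη : 0 < η) : ContDiff ℝ ∞ (regPowDeriv r η) := by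
  unfold regPowDeriv
  exact (contDiff_const.mul contDiff_id).mul
    ((contDiff_id.pow 2 |>.add contDiff_const).rpow_const_of_ne fun y => (regPow_base_pos hη y).ne')

/-- `φ' = dφ/dy`. [folklore] -/
theorem hasDerivAt_regPow (hη : 0 < η) (y : ℝ) : HasDerivAt (regPow r η) (regPowDeriv r η y) y := by
  have hb : HasDerivAt (fun y : ℝ => y ^ 2 + η ^ 2) (2 * y) y := by
    simpa using (hasDerivAt_pow 2 y).add_const (η ^ 2)
  have h := hb.rpow_const (p := r / 2) (Or.inl (regPow_base_pos hη y).ne')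
  unfold regPow regPowDeriv
  convert h using 1
  ring

/-- `φ'' = dφ'/dy`. [folklore] -/
theorem hasDerivAt_regPowDeriv (hη : 0 < η) (y : ℝ) :
    HasDerivAt (regPowDeriv r η) (regPowDeriv₂ r η y) y := by
  have hb : HasDerivAt (fun y : ℝ => y ^ 2 + η ^ 2) (2 * y) y := by
    simpa using (hasDerivAt_pow 2 y).add_const (η ^ 2)
  have hpow := hb.rpow_const (p := r / 2 - 1) (Or.inl (regPow_base_pos hη y).ne')
  have hlin : HasDerivAt (fun y : ℝ => r * y) (r * 1) y := (hasDerivAt_id y).const_mul r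
  have h := hlin.fun_mul hpow
  have hfun : regPowDeriv r η = fun y : ℝ => r * y * (y ^ 2 + η ^ 2) ^ (r / 2 - 1) := rfl
  rw [hfun]
  refine h.congr_deriv ?_
  have hb0 : 0 < y ^ 2 + η ^ 2 := regPow_base_pos hη y
  have hsplit : (y ^ 2 + η ^ 2) ^ (r / 2 - 1) = (y ^ 2 + η ^ 2) ^ (r / 2 - 2) * (y ^ 2 + η ^ 2) := by
    rw [show r / 2 - 1 = (r / 2 - 2) + 1 by ring, Real.rpow_add hb0, Real.rpow_one]
  unfold regPowDeriv₂
  rw [show r / 2 - 1 - 1 = r / 2 - 2 by ring, hsplit]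
  ring

/-- `φ'' ≥ 0` for `r ≥ 1`: `φ` is convex. [folklore] -/
theorem regPowDeriv₂_nonneg (hη : 0 < η) (hr : 1 ≤ r) (y : ℝ) : 0 ≤ regPowDeriv₂ r η y := by
  unfold regPowDeriv₂
  have h1 : 0 ≤ (y ^ 2 + η ^ 2) ^ (r / 2 - 2) := Real.rpow_nonneg (regPow_base_pos hη y).le _
  have h2 : 0 ≤ (r - 1) * y ^ 2 + η ^ 2 := by nlinarith [sq_nonneg y, sq_nonneg η]
  have h0 : 0 ≤ r := by linarith
  positivity

/-- `φ > 0`. [folklore] -/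
theorem regPow_pos (hη : 0 < η) (y : ℝ) : 0 < regPow r η y :=
  Real.rpow_pos_of_pos (regPow_base_pos hη y) _

/-- `|y|^r ≤ φ(y)` for `r ≥ 0`. [folklore] -/
theorem abs_rpow_le_regPow (hr : 0 ≤ r) (y : ℝ) : |y| ^ r ≤ regPow r η y := by
  unfold regPow
  have h1 : |y| ^ r = (y ^ 2) ^ (r / 2) := by
    rw [← sq_abs, ← Real.rpow_natCast, ← Real.rpow_mul (abs_nonneg y)]
    norm_num
    rw [mul_div_cancel₀ r two_ne_zero]
  rw [h1]
  exact Real.rpow_le_rpow (sq_nonneg y) (by nlinarith [sq_nonneg η]) (by linarith)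

/-- `φ(0) = η^r`. [folklore] -/
theorem regPow_zero (hη : 0 < η) : regPow r η 0 = η ^ r := by
  unfold regPow
  rw [zero_pow two_ne_zero, zero_add, ← Real.rpow_natCast, ← Real.rpow_mul hη.le]
  norm_num
  rw [mul_div_cancel₀ r two_ne_zero]

/-- The key pointwise inequality `|φ'(y)|^{r'} ≤ r^{r'} φ(y)` with `r' = r/(r-1)` (`r > 1`):
from `|φ'(y)| = r|y|(y²+η²)^{r/2-1} ≤ r (y²+η²)^{(r-1)/2}`. [folklore] -/
theorem abs_regPowDeriv_rpow_le (hη : 0 < η) (hr : 1 < r) (y : ℝ) :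
    |regPowDeriv r η y| ^ (r / (r - 1)) ≤ r ^ (r / (r - 1)) * regPow r η y := by
  have hb0 : 0 < y ^ 2 + η ^ 2 := regPow_base_pos hη y
  have hr0 : 0 < r := by linarith
  have hr1 : 0 < r - 1 := by linarith
  -- `|φ'(y)| ≤ r (y²+η²)^{(r-1)/2}`
  have hy : |y| ≤ (y ^ 2 + η ^ 2) ^ (1 / 2 : ℝ) := by
    rw [← Real.sqrt_eq_rpow, Real.le_sqrt (abs_nonneg y) hb0.le, sq_abs]
    nlinarith [sq_nonneg η]
  have habs : |regPowDeriv r η y| ≤ r * (y ^ 2 + η ^ 2) ^ ((r - 1) / 2) := by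
    unfold regPowDeriv
    rw [abs_mul, abs_mul, abs_of_pos hr0, abs_of_pos (Real.rpow_pos_of_pos hb0 _)]
    calc r * |y| * (y ^ 2 + η ^ 2) ^ (r / 2 - 1)
        ≤ r * (y ^ 2 + η ^ 2) ^ (1 / 2 : ℝ) * (y ^ 2 + η ^ 2) ^ (r / 2 - 1) := by
          gcongr
      _ = r * (y ^ 2 + η ^ 2) ^ ((r - 1) / 2) := by
          rw [mul_assoc, ← Real.rpow_add hb0]
          congr 2
          ring
  have hnn : 0 ≤ |regPowDeriv r η y| := abs_nonneg _
  calc |regPowDeriv r η y| ^ (r / (r - 1))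
      ≤ (r * (y ^ 2 + η ^ 2) ^ ((r - 1) / 2)) ^ (r / (r - 1)) :=
        Real.rpow_le_rpow hnn habs (div_pos hr0 hr1).le
    _ = r ^ (r / (r - 1)) * ((y ^ 2 + η ^ 2) ^ ((r - 1) / 2)) ^ (r / (r - 1)) :=
        Real.mul_rpow hr0.le (Real.rpow_nonneg hb0.le _)
    _ = r ^ (r / (r - 1)) * regPow r η y := by
        unfold regPow
        rw [← Real.rpow_mul hb0.le]
        congr 2
        field_simp

end RegPow

/-! ## The energy estimate -/

section Energy

variable [DecidableEq d] {r η : ℝ}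

/-- Chain rule along coordinate lines: `∂ᵢ(φ ∘ w) = φ'(w) ∂ᵢw` for `C¹` scalar `w` on the torus
and differentiable `φ : ℝ → ℝ`. [folklore] -/
theorem partialDeriv_comp_apply {φ φ' : ℝ → ℝ} (hφ : ∀ y, HasDerivAt φ (φ' y) y)
    {w : UnitAddTorus d → ℝ} (hw : IsContDiff 1 w) (i : d) (x : UnitAddTorus d) :
    FunctionSpaces.Torus.partialDeriv i (fun z => φ (w z)) x = φ' (w x) * FunctionSpaces.Torus.partialDeriv i w x := by
  have hin := hasDerivAt_comp_add_proj_smul hw x (EuclideanSpace.single i (1 : ℝ)) 0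
  have hx0 : x + proj ((0 : ℝ) • EuclideanSpace.single i (1 : ℝ)) = x := by
    rw [zero_smul, proj_zero, add_zero]
  rw [hx0] at hin
  have h := (hφ (w x)).comp_of_eq (0 : ℝ) hin (by simp only [zero_smul, proj_zero, add_zero])
  change deriv (fun t : ℝ => φ (w (x + proj (t • EuclideanSpace.single i (1 : ℝ))))) 0 =
    φ' (w x) * deriv (fun t : ℝ => w (x + proj (t • EuclideanSpace.single i (1 : ℝ)))) 0
  rw [hin.deriv]
  exact h.deriv

/-- **Dissipativity**: `∫ φ'(w) Δw = -∑ᵢ ∫ φ''(w) (∂ᵢw)² ≤ 0` for smooth `w` on the torus and the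
convex regularised power `φ = regPow r η` (`η > 0`, `r ≥ 1`). [folklore] -/
theorem integral_regPowDeriv_mul_laplacian_nonpos (hη : 0 < η) (hr : 1 ≤ r)
    {w : UnitAddTorus d → ℝ} (hw : IsSmooth w) :
    ∫ x, regPowDeriv r η (w x) * FunctionSpaces.Torus.laplacian w x ≤ 0 := by
  have ha : IsSmooth (fun x => regPowDeriv r η (w x)) := (contDiff_regPowDeriv hη).comp hw
  rw [integral_mul_laplacian_eq_neg_sum ha hw, neg_nonpos]
  refine Finset.sum_nonneg fun i _ => integral_nonneg fun x => ?_
  have hw1 : IsContDiff 1 w := hw.isContDiff (by simp)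
  rw [partialDeriv_comp_apply (hasDerivAt_regPowDeriv hη) hw1 i x, mul_assoc, ← sq]
  exact mul_nonneg (regPowDeriv₂_nonneg hη hr _) (sq_nonneg _)

omit [DecidableEq d] in
/-- Continuous real functions on the torus are in every `L^p`. [folklore] -/
private theorem memLp_of_continuous_real {f : UnitAddTorus d → ℝ} (hf : Continuous f) (p : ℝ≥0∞) :
    MemLp f p volume :=
  hf.memLp_of_hasCompactSupport (HasCompactSupport.of_compactSpace f)

omit [DecidableEq d] in
/-- **Hölder step**: `∫ φ'(w) g ≤ r (∫ φ(w))^{(r-1)/r} (∫ |g|^r)^{1/r}` for continuous `w`, `g`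
(`|φ'| ^ {r'} ≤ r^{r'} φ`, `r' = r/(r-1)`). [folklore] -/
theorem integral_regPowDeriv_mul_le (hη : 0 < η) (hr : 1 < r) {w g : UnitAddTorus d → ℝ}
    (hw : Continuous w) (hg : Continuous g) :
    ∫ x, regPowDeriv r η (w x) * g x ≤
      r * (∫ x, regPow r η (w x)) ^ ((r - 1) / r) * (∫ x, |g x| ^ r) ^ (1 / r) := by
  have hr0 : 0 < r := by linarith
  have hr1 : 0 < r - 1 := by linarith
  set r' : ℝ := r / (r - 1) with hr'_def
  have hpq : r'.HolderConjugate r := (Real.HolderConjugate.conjExponent hr).symm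
  have hr'0 : 0 < r' := div_pos hr0 hr1
  have hφ'c : Continuous fun x => regPowDeriv r η (w x) := (contDiff_regPowDeriv hη).continuous.comp hw
  have hφc : Continuous fun x => regPow r η (w x) := (contDiff_regPow hη).continuous.comp hw
  -- `∫ φ'(w) g ≤ ∫ |φ'(w)| |g|`
  have h1 : ∫ x, regPowDeriv r η (w x) * g x ≤ ∫ x, |regPowDeriv r η (w x)| * |g x| := by
    refine integral_mono (hφ'c.mul hg).integrable_unitAddTorus
      ((continuous_abs.comp hφ'c).mul (continuous_abs.comp hg)).integrable_unitAddTorus fun x => ?_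
    rw [← abs_mul]
    exact le_abs_self _
  -- Hölder
  have h2 : ∫ x, |regPowDeriv r η (w x)| * |g x| ≤
      (∫ x, |regPowDeriv r η (w x)| ^ r') ^ (1 / r') * (∫ x, |g x| ^ r) ^ (1 / r) :=
    integral_mul_le_Lp_mul_Lq_of_nonneg hpq (Eventually.of_forall fun x => abs_nonneg _)
      (Eventually.of_forall fun x => abs_nonneg _)
      (memLp_of_continuous_real (continuous_abs.comp hφ'c) _)
      (memLp_of_continuous_real (continuous_abs.comp hg) _)
  -- `(∫ |φ'(w)|^{r'})^{1/r'} ≤ r (∫ φ(w))^{1/r'}`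
  have h3 : (∫ x, |regPowDeriv r η (w x)| ^ r') ^ (1 / r') ≤
      r * (∫ x, regPow r η (w x)) ^ ((r - 1) / r) := by
    have hmono : ∫ x, |regPowDeriv r η (w x)| ^ r' ≤ ∫ x, r ^ r' * regPow r η (w x) := by
      refine integral_mono ?_ ((hφc.const_smul (r ^ r')).integrable_unitAddTorus) fun x =>
        abs_regPowDeriv_rpow_le hη hr (w x)
      exact ((continuous_abs.comp hφ'c).rpow_const fun x => Or.inr hr'0.le).integrable_unitAddTorus
    have hI0 : 0 ≤ ∫ x, |regPowDeriv r η (w x)| ^ r' :=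
      integral_nonneg fun x => Real.rpow_nonneg (abs_nonneg _) _
    have hJ0 : 0 ≤ ∫ x, regPow r η (w x) := integral_nonneg fun x => (regPow_pos hη _).le
    have hinv : 1 / r' = (r - 1) / r := by rw [hr'_def]; field_simp
    calc (∫ x, |regPowDeriv r η (w x)| ^ r') ^ (1 / r')
        ≤ (∫ x, r ^ r' * regPow r η (w x)) ^ (1 / r') :=
          Real.rpow_le_rpow hI0 hmono (by positivity)
      _ = (r ^ r' * ∫ x, regPow r η (w x)) ^ (1 / r') := by rw [integral_const_mul]
      _ = (r ^ r') ^ (1 / r') * (∫ x, regPow r η (w x)) ^ (1 / r') :=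
          Real.mul_rpow (by positivity) hJ0
      _ = r * (∫ x, regPow r η (w x)) ^ ((r - 1) / r) := by
          rw [hinv, ← Real.rpow_mul hr0.le, show r' * ((r - 1) / r) = 1 by
            rw [hr'_def]; field_simp, Real.rpow_one]
  have hG0 : 0 ≤ (∫ x, |g x| ^ r) ^ (1 / r) :=
    Real.rpow_nonneg (integral_nonneg fun x => Real.rpow_nonneg (abs_nonneg _) _) _
  calc ∫ x, regPowDeriv r η (w x) * g x
      ≤ ∫ x, |regPowDeriv r η (w x)| * |g x| := h1
    _ ≤ (∫ x, |regPowDeriv r η (w x)| ^ r') ^ (1 / r') * (∫ x, |g x| ^ r) ^ (1 / r) := h2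
    _ ≤ r * (∫ x, regPow r η (w x)) ^ ((r - 1) / r) * (∫ x, |g x| ^ r) ^ (1 / r) :=
        mul_le_mul_of_nonneg_right h3 hG0

omit [DecidableEq d] in
/-- The `L^r` norm of a continuous real function on the torus as a real number:
`‖g‖_r = (∫ |g|^r)^{1/r}`. [folklore] -/
theorem toReal_eLpNorm_eq_rpow_integral {g : UnitAddTorus d → ℝ} (hg : Continuous g) (hr : 0 < r) :
    (eLpNorm g (ENNReal.ofReal r) volume).toReal = (∫ x, |g x| ^ r) ^ (1 / r) := by
  rw [(memLp_of_continuous_real hg (ENNReal.ofReal r)).eLpNorm_eq_integral_rpow_norm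
      (by simp [hr]) ENNReal.ofReal_ne_top, ENNReal.toReal_ofReal_eq_iff.2 ?_,
    ENNReal.toReal_ofReal hr.le, one_div]
  · simp_rw [Real.norm_eq_abs]
  · exact Real.rpow_nonneg (integral_nonneg fun x => Real.rpow_nonneg (norm_nonneg _) _) _

/-- **`L^r`-accretivity of the forced heat flow on the torus (energy estimate).** Let `κ ≥ 0`,
`a < b`, `θ` and `g` jointly smooth on `[a, b] × 𝕋^d` with `∂ₜθ = κΔθ + g` pointwise (one-sided
time derivative within `[a, b]`) and `θ(a) = 0`. Then for `1 < r < ∞` and `t ∈ [a, b]`,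
`‖θ(t)‖_{L^r} ≤ ∫ₐᵗ ‖g(s)‖_{L^r} ds`. This is the "standard energy method" of the proof of
Cheskidov–Luo 2022, Prop. 3.2, for the heat operator itself (there applied to `z = ℛvᵢ` after a
Calderón–Zygmund bound on the forcing). Proof in the module docstring (regularised powers
`(θ² + η²)^{r/2}`, Green's identity, Hölder, comparison, `η → 0`). [cite: CheskidovLuo2022, Prop. 3.2 (proof)] -/
theorem eLpNorm_le_integral_of_heat {a b κ : ℝ} (hab : a < b) (hκ : 0 ≤ κ)
    {θ g : ℝ → UnitAddTorus d → ℝ} (hθ : FunctionSpaces.Torus.IsSmoothSpaceTimeOn (Icc a b) θ)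
    (hg : FunctionSpaces.Torus.IsSmoothSpaceTimeOn (Icc a b) g)
    (heq : ∀ t ∈ Icc a b, ∀ x,
      FunctionSpaces.Torus.timeDerivWithin (Icc a b) θ t x = κ * FunctionSpaces.Torus.laplacian (θ t) x + g t x)
    (h0 : ∀ x, θ a x = 0) (hr : 1 < r) {t : ℝ} (ht : t ∈ Icc a b) :
    (eLpNorm (θ t) (ENNReal.ofReal r) volume).toReal ≤
      ∫ s in a..t, (eLpNorm (g s) (ENNReal.ofReal r) volume).toReal := by
  have hr0 : 0 < r := by linarith
  set S : Set ℝ := Icc a b with hS_def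
  have hU : UniqueDiffOn ℝ S := uniqueDiffOn_Icc hab
  -- the forcing norm `G` and its continuity
  set G : ℝ → ℝ := fun s => (eLpNorm (g s) (ENNReal.ofReal r) volume).toReal with hG_def
  have hGc : ContinuousOn G S :=
    hg.continuousOn_eLpNorm_toReal (by simpa using hr.le : (1 : ℝ≥0∞) ≤ ENNReal.ofReal r)
  have hGeq : ∀ s ∈ S, G s = (∫ x, |g s x| ^ r) ^ (1 / r) := fun s hs =>
    toReal_eLpNorm_eq_rpow_integral (hg.isSmooth_slice hs).continuous hr0
  -- it suffices to prove the bound up to `η > 0`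
  refine le_of_forall_pos_le_add fun η hη => ?_
  -- the regularised energy `N(s) = ∫ φ(θ s)` and its derivative
  set Φ : ℝ → UnitAddTorus d → ℝ := fun s x => regPow r η (θ s x) with hΦ_def
  have hΦ : FunctionSpaces.Torus.IsSmoothSpaceTimeOn S Φ := (contDiff_regPow hη).comp_contDiffOn hθ
  set N : ℝ → ℝ := fun s => ∫ x, Φ s x with hN_def
  have hN : ∀ s ∈ S, HasDerivWithinAt N (∫ x, FunctionSpaces.Torus.timeDerivWithin S Φ s x) S s := fun s hs =>
    hΦ.hasDerivWithinAt_integral (convex_Icc a b) hs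
  -- `∂ₜΦ = φ'(θ) ∂ₜθ`
  have hΦ' : ∀ s ∈ S, ∀ x, FunctionSpaces.Torus.timeDerivWithin S Φ s x =
      regPowDeriv r η (θ s x) * FunctionSpaces.Torus.timeDerivWithin S θ s x := by
    intro s hs x
    have h1 : HasDerivWithinAt (fun τ => θ τ x) (FunctionSpaces.Torus.timeDerivWithin S θ s x) S s :=
      hθ.hasDerivWithinAt_slice hs x
    have h2 := (hasDerivAt_regPow (r := r) hη (θ s x)).comp_hasDerivWithinAt s h1
    exact h2.derivWithin (hU s hs)
  -- the derivative bound `N' ≤ r N^{(r-1)/r} G`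
  have hN0 : ∀ s ∈ S, 0 < N s := by
    intro s hs
    have hcont : Continuous (Φ s) := (hΦ.isSmooth_slice hs).continuous
    have hle : ∫ _x : UnitAddTorus d, (η ^ r : ℝ) ≤ N s := by
      refine integral_mono (integrable_const _) hcont.integrable_unitAddTorus fun x => ?_
      change η ^ r ≤ regPow r η (θ s x)
      rw [← regPow_zero (r := r) hη]
      unfold regPow
      refine Real.rpow_le_rpow (by positivity) (by nlinarith [sq_nonneg (θ s x)]) (by linarith)
    have hc : ∫ _x : UnitAddTorus d, (η ^ r : ℝ) = η ^ r := by simp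
    rw [hc] at hle
    exact lt_of_lt_of_le (Real.rpow_pos_of_pos hη r) hle
  have hN' : ∀ s ∈ S, ∫ x, FunctionSpaces.Torus.timeDerivWithin S Φ s x ≤ r * N s ^ ((r - 1) / r) * G s := by
    intro s hs
    have hθs : IsSmooth (θ s) := hθ.isSmooth_slice hs
    have hgs : IsSmooth (g s) := hg.isSmooth_slice hs
    have hφ'c : Continuous fun x => regPowDeriv r η (θ s x) :=
      (contDiff_regPowDeriv hη).continuous.comp hθs.continuous
    have hsplit : ∀ x, FunctionSpaces.Torus.timeDerivWithin S Φ s x =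
        κ * (regPowDeriv r η (θ s x) * FunctionSpaces.Torus.laplacian (θ s) x) +
          regPowDeriv r η (θ s x) * g s x := by
      intro x
      rw [hΦ' s hs x, heq s hs x]
      ring
    simp_rw [hsplit]
    have hi1 : Integrable (fun x => regPowDeriv r η (θ s x) * FunctionSpaces.Torus.laplacian (θ s) x) volume :=
      (hφ'c.mul hθs.laplacian.continuous).integrable_unitAddTorus
    have hi2 : Integrable (fun x => regPowDeriv r η (θ s x) * g s x) volume :=
      (hφ'c.mul hgs.continuous).integrable_unitAddTorus
    rw [integral_add (hi1.const_mul κ) hi2, integral_const_mul]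
    have hA : κ * ∫ x, regPowDeriv r η (θ s x) * FunctionSpaces.Torus.laplacian (θ s) x ≤ 0 :=
      mul_nonpos_of_nonneg_of_nonpos hκ (integral_regPowDeriv_mul_laplacian_nonpos hη hr.le hθs)
    have hB := integral_regPowDeriv_mul_le hη hr hθs.continuous hgs.continuous
    rw [← hGeq s hs] at hB
    linarith
  -- `P = N^{1/r}` has `P' ≤ G` within `S`
  set P : ℝ → ℝ := fun s => N s ^ (1 / r) with hP_def
  set P' : ℝ → ℝ := fun s => (∫ x, FunctionSpaces.Torus.timeDerivWithin S Φ s x) * (1 / r) * N s ^ (1 / r - 1)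
    with hP'_def
  have hP : ∀ s ∈ S, HasDerivWithinAt P (P' s) S s := fun s hs =>
    (hN s hs).rpow_const (Or.inl (hN0 s hs).ne')
  have hP'le : ∀ s ∈ S, P' s ≤ G s := by
    intro s hs
    have hNs := hN0 s hs
    have hfac : 0 ≤ (1 / r) * N s ^ (1 / r - 1) := by positivity
    calc P' s = (∫ x, FunctionSpaces.Torus.timeDerivWithin S Φ s x) * ((1 / r) * N s ^ (1 / r - 1)) := by
          rw [hP'_def]; ring
      _ ≤ (r * N s ^ ((r - 1) / r) * G s) * ((1 / r) * N s ^ (1 / r - 1)) :=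
          mul_le_mul_of_nonneg_right (hN' s hs) hfac
      _ = G s * (N s ^ ((r - 1) / r) * N s ^ (1 / r - 1)) := by
          field_simp
      _ = G s := by
          rw [← Real.rpow_add hNs, show (r - 1) / r + (1 / r - 1) = 0 by field_simp; ring,
            Real.rpow_zero, mul_one]
  -- comparison with `B(s) = η + ∫ₐˢ G` on `[a, t]`
  have hat : a ≤ t := ht.1
  have htb : t ≤ b := ht.2
  set Gc : ℝ → ℝ := fun s => G (max a (min s b)) with hGc_def
  have hclamp_mem : ∀ s, max a (min s b) ∈ S := fun s =>
    ⟨le_max_left _ _, max_le hab.le (min_le_right _ _)⟩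
  have hclamp_id : ∀ s ∈ S, max a (min s b) = s := fun s hs => by
    rw [min_eq_left hs.2, max_eq_right hs.1]
  have hGcc : Continuous Gc :=
    hGc.comp_continuous (continuous_const.max (continuous_id.min continuous_const)) hclamp_mem
  set B : ℝ → ℝ := fun s => η + ∫ τ in a..s, Gc τ with hB_def
  have hB : ∀ s, HasDerivAt B (Gc s) s := fun s => by
    have h := (intervalIntegral.integral_hasDerivAt_right (hGcc.intervalIntegrable a s)
      (hGcc.stronglyMeasurableAtFilter volume (𝓝 s)) hGcc.continuousAt).const_add η
    rw [hB_def]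
    exact h
  have hPa : P a = η := by
    have hNa : N a = η ^ r := by
      change ∫ x, regPow r η (θ a x) = η ^ r
      simp_rw [h0, regPow_zero hη]
      simp
    rw [hP_def]
    change N a ^ (1 / r) = η
    rw [hNa, one_div, Real.rpow_rpow_inv hη.le hr0.ne']
  have hcmp : P t ≤ B t := by
    have hPc : ContinuousOn P (Icc a t) := fun s hs =>
      ((hP s ⟨hs.1, hs.2.trans htb⟩).continuousWithinAt).mono (Icc_subset_Icc le_rfl htb)
    refine image_le_of_deriv_right_le_deriv_boundary (f' := P') (B' := Gc) hPc (fun s hs => ?_) (by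
      simp [hB_def, hPa]) (fun s _ => (hB s).continuousAt.continuousWithinAt)
      (fun s _ => (hB s).hasDerivWithinAt) (fun s hs => ?_) (right_mem_Icc.2 hat)
    · have hsS : s ∈ S := ⟨hs.1, (hs.2.trans_le htb).le⟩
      have hsb : s < b := hs.2.trans_le htb
      exact (hP s hsS).mono_of_mem_nhdsWithin
        (mem_of_superset (Icc_mem_nhdsGE hsb) (Icc_subset_Icc hs.1 le_rfl))
    · have hsS : s ∈ S := ⟨hs.1, (hs.2.trans_le htb).le⟩
      rw [hGc_def]
      dsimp only
      rw [hclamp_id s hsS]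
      exact hP'le s hsS
  -- `‖θ(t)‖_r ≤ P t` and `B t = η + ∫ₐᵗ G`
  have hθt : IsSmooth (θ t) := hθ.isSmooth_slice ht
  have hL : (eLpNorm (θ t) (ENNReal.ofReal r) volume).toReal ≤ P t := by
    rw [toReal_eLpNorm_eq_rpow_integral hθt.continuous hr0]
    refine Real.rpow_le_rpow (integral_nonneg fun x => Real.rpow_nonneg (abs_nonneg _) _)
      (integral_mono ?_ (hΦ.isSmooth_slice ht).continuous.integrable_unitAddTorus fun x =>
        abs_rpow_le_regPow hr0.le (θ t x)) (by positivity)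
    exact ((continuous_abs.comp hθt.continuous).rpow_const fun x => Or.inr hr0.le).integrable_unitAddTorus
  have hBt : B t = η + ∫ s in a..t, G s := by
    rw [hB_def]
    dsimp only
    congr 1
    refine intervalIntegral.integral_congr fun s hs => ?_
    rw [uIcc_of_le hat] at hs
    rw [hGc_def]
    dsimp only
    rw [hclamp_id s ⟨hs.1, hs.2.trans htb⟩]
  linarith [hL, hcmp, hBt]

end Energy

end Torus

end Literature.Analysis.FluidPDE
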